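/-
Copyright (c) 2026 the pub-hodgecm-mathlib formalisation cell (harness21).  Prover seat hodgecm-mathlib-F0P3a-p04 (g32): E1 row 61b «THE `hsp` SUPPLIER, DISCHARGED» = the
`h61` binder of the K1-UNR road (E1 keeper ∕ dealer F0P3a-p03 (g30) 04:35:49Z ∕ 04:36:58Z; binder block ruled 04:43:30Z with the row-58 pen «LH5» LH5-p02 (g11) 04:48:58Z), over
★ 61a ED. 1 (F0P2-p06), ★ 61-G (F0P2-p06), ★ 61-σ (F0P2-p06), ★ 5b ∕ M2 ∕ M3 ∕ M4 (this lineage), ★ 55-B B-1∕B-2∕B-3a∕B-3b (LH10-p02), 2026-09-03.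
-/
import Summits.HodgeConjecture.HodgeConjecture.Theorems.F0P3cStCharTSEPInducedTraceZeroAtDatum   -- ★ ED. 1
import Summits.HodgeConjecture.HodgeConjecture.Theorems.F0P3cStCharTSHorocycleDataAtDatum         -- ★ B-2 (X1)(X2) (+ ★ B-1)
import Summits.HodgeConjecture.HodgeConjecture.Theorems.F0P3cStCharTSBorelDoubleCosetsAtDatum      -- ★ B-3a (X3)(X4) vertices
import Summits.HodgeConjecture.HodgeConjecture.Theorems.F0P3cStCharTSTreeOrbitDataGqs              -- ★ two vertex orbits, one edge orbit
import Summits.HodgeConjecture.HodgeConjecture.Theorems.F0P3cStCharTSBorelDoubleCosetsIwahoriAtDatum -- ★ B-3b (+ ED. 2 dock) edge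
import Summits.HodgeConjecture.HodgeConjecture.Theorems.F0P3cStCharTSPrincipalSeriesLine        -- ★ 61-σ (F0P2-p06): hσχ hNχ hχo hτsm, carrier bridge
import Literature.NumberTheory.Automorphic.SchneiderStuhlerEPInducedTraceBlockMultiplicity         -- ★ 61-G (F0P2-p06): the blockwise multiplicities
import Literature.NumberTheory.Automorphic.SchneiderStuhlerTreeJacquetEulerIsotypic                -- ★ 5b
import Literature.NumberTheory.Automorphic.SchneiderStuhlerEPInducedTracePerType                   -- ★ 60
import Literature.NumberTheory.Automorphic.SchneiderStuhlerTreeLocalModel                         -- ★ M2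
import Literature.NumberTheory.Automorphic.SchneiderStuhlerEPInducedTraceLocalData                -- ★ M3
import Literature.NumberTheory.Automorphic.SchneiderStuhlerEPInducedTraceDockAdapters              -- ★ M4
import Literature.NumberTheory.Automorphic.UnitaryGroupUnipotentLimitCompactOpen                  -- ★ `isLimitOfCompactOpen_cmBorelTriple_N`, `jacquetMap_cmBorel_injective`
import Literature.NumberTheory.Automorphic.CMPrincipalSeriesJacquetEvalOne                         -- ★ `continuous_apply_proj_borelTriple`
import Literature.NumberTheory.Automorphic.VanDijkTraceParabolicIndGLProof                         -- ★ `continuous_rootDeltaChar_unitsCoe'`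
import HarnessLib


/-!
# F0 · P3c · «StCharTS» — E1 ROW 61b: `tr i_G(χ)(f_EP) = 0` AT THE DATUM, UNCONDITIONALLY — the `h61` binder of the K1-UNR pseudo-coefficient road, discharged
# ([SchneiderStuhler1997 III.4.18]; [Kottwitz1988 §2]; [Rogawski1990 §12.5])

Cell `pub/hodgecm-mathlib` (D-0151), crux H413 = `stmt-HodgeConjecture-24833`, lane `--supports … --as helper`, route HCCMUnconditional; namespace
`Summit.HodgeConjecture.HodgeConjecture.Cruxes.H413.F0P3cStCharTSEPInducedTraceZeroAtDatum` (continued from ★ ED. 1; a sibling module because the discharge needs eleven ★ imports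
ED. 1 does not have and ED. 1 + ED. 2 would pass the 400-line fence).  THEOREMS ONLY (no definition, no instance, no notation, no named fact, no `sorry`).  Seat F0P3a-p04 (g32).
HONEST LABEL: count-neutral datum assembly; E1 = PRINT until the rider rides; h413 OPEN; HC_CM is proved only modulo the 7 printed citations (2 remaining named inputs: hLiu418 =
`stmt-HodgeConjecture-24832`, h413 = `stmt-HodgeConjecture-24833`) until rung 0 closes.

THE STATEMENT (= the `h61` binder of ★-to-be `F0P3cStCharTSK1UnrPseudoCoeffWitness.isPseudoCoeff_epFunction_of_unramified_explicit`, cert v6 of «LH5» LH5-p02 (g11), VERBATIM after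
`(w hw) {ϖ} (hd) (eA) (heA)`): at an unramified non-split place `v` with the (G3)-EXPLICIT one-place model `(w hw ϖ hd eA heA)` of `G_v = U(Φ₃)(L⁺_v)`, for the tree letters
`{a} ha τ hτ {e U} hU hUo hUc hEo hEc` of ★ 41g-H, the STANDARD APARTMENT `{A} hA0 hA1` (★ 39γ `exists_apartmentEnum`) with base edge `d₁ = {A 0, A 1}` (`hd₁`), its
stabilisers `P₀ P₂ P₁` (`hP₀ hP₂ hP₁`), ANY smooth representation `ρ` with finite-dimensional Jacquet module `(V)_N` (`hρ hVN`) and finite-dimensional `V^{U_q}` at the three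
facets, the `K`-types `τ_q = ρ|_{P_q}` on `V^{U_q}` (`hτρ_q`, trivial on `U_q`: `hτ_q`), the pieces `f_q = 𝟙_{P_q} χ_{τ_q}(·⁻¹)` (★ row 42 letters `hfP_q hf0_q`), and EVERY continuous
character `χ` of the diagonal torus `T(L⁺_v)`:
`tr i_G(χ)((ν P₀)⁻¹ f₀ + (ν P₂)⁻¹ f₂ − (ν P₁)⁻¹ f₁) = 0`.
* `finrank_intertwiningMap_smoothIndRep_cmBorel_eq` — THE CARRIER BRIDGE ON MULTIPLICITIES (★ 61-σ (β) under `finrank ∘ IntertwiningMap`), isolated: the one step that moves ★ 61-G's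
  `Ind_B^G σχ` currency into ★ ED. 1 §3's `cmPrincipalSeries` currency (a `whnf` wall > 3.2 M heartbeats when rewritten inside the assembly; 20 s here by `congrArg`).
* **`smoothTrace_cmPrincipalSeries_epFunction_eq_zero`** — THE DISCHARGE.  Proof = ★ ED. 1 §3 `…_eq_zero_of_blockSums` fed with: `hEuler` := ★ 5b `sum_finrank_block_eigen_eq_of_tree` at
  the datum (tree axioms ★ 41g-H §2, head∕tail of `d₁` = `A 0`∕`A 1` by types ★ `type_of_lt_three`, torus translation ★ B-1 (X0), horocycle vertex∕edge data ★ B-2, compact torus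
  `C = T ∩ Stab(A 0)` ★ B-1, the inducing character `χ̃ = δ_B^{1∕2}·(χ∘proj)` with OPEN kernel on `B` and on `C` (★ 61-σ ∕ ★ M4 ∕ ★ `continuous_proj_borelTriple` ∕
  ★ `continuous_rootDeltaChar_unitsCoe'`), the global complex ★ 41d-II ∕ ★ 5a, `hfd` at EVERY vertex from the two vertex orbits ★ `mem_headOrbit_or_mem_tailOrbit` + ★ M2, `(V|_X)_N`
  finite-dimensional from `hVN` by Jacquet left exactness ★ `jacquetMap_cmBorel_injective`, the three `χ̃|_C`-eigenspaces ★ M3 `exists_eigenSubmodule`); `hm₀ hm₂ hm₁` := ★ 61-G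
  `…_block_eigen_zeroChains` ×2 ∕ `…_oneChains` ×1 over ★ B-3a `borelDoubleCoset_vertex` (`m = 0, 1`), ★ B-3b `borelDoubleCoset_edge` + `borelDoubleCoset_edge_dock`, ★ 61-σ
  (`hσχ hNχ hχo hτsm hW1`); blocks `S₀ = {A 0, A 1}`, `S₁ = {e₀, e₁}` with the Mackey representatives `1, 1` and `1, τM·w₀` (★ B-3b `mapEdgeSet_tau_weylLong_apartmentEnum_zero`).
  One theorem, `maxHeartbeats 3200000` measured (rc 1 at 1.6 M on the `hS₁` Finset bookkeeping over the datum edge type; 132 s on the farm) — the 41g-H ∕ 48-datum `whnf` wall.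

## References
* [SchneiderStuhler1997] P. Schneider, U. Stuhler, *Representation theory and sheaves on the Bruhat–Tits building*, Publ. Math. IHÉS 85 (1997), §III.4, Lemma III.4.13, Lemma III.4.18.
* [Kottwitz1988] R. Kottwitz, *Tamagawa numbers*, Ann. of Math. 127 (1988), §2.
* [Rogawski1990] J. D. Rogawski, *Automorphic Representations of Unitary Groups in Three Variables* (1990), §1.10 p. 9; §4.5 p. 45; §12.2 p. 173; §12.5 pp. 182–187.
* [BernsteinZelevinsky1977] I. N. Bernstein, A. V. Zelevinsky, *Induced representations of reductive 𝔭-adic groups I*, Ann. Sci. ÉNS 10 (1977), §2.3, Thm 5.2.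
* [Casselman1995] W. Casselman, *Introduction to the theory of admissible representations of `p`-adic reductive groups* (1995 notes), §3.2, §6.3.
* [BruhatTits1972] F. Bruhat, J. Tits, *Groupes réductifs sur un corps local I*, Publ. Math. IHÉS 41 (1972), (4.4.3)–(4.4.4), §10.
-/

set_option autoImplicit false
set_option linter.dupNamespace false

open NumberField IsDedekindDomain MeasureTheory Measure
open scoped Pointwise Valued WithZero Matrix MatrixGroups
open Literature.NumberTheory.Rogawski1990 Literature.NumberTheory.Rogawski1990.Ch12Sec5
open Literature.NumberTheory.Automorphic Literature.NumberTheory.Automorphic.UnitaryGroup Literature.NumberTheory.Automorphic.UnitaryLatticeTree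
open Literature.NumberTheory.Automorphic.HermitianLattice Literature.NumberTheory.GaloisRepresentations
open Literature.Combinatorics.SimpleGraph Literature.Combinatorics.SimpleGraph.OrientedIncidence

namespace Summit.HodgeConjecture.HodgeConjecture.Cruxes.H413.F0P3cStCharTSEPInducedTraceZeroAtDatum

open Summit.HodgeConjecture.HodgeConjecture.Cruxes.H413
open Summit.HodgeConjecture.HodgeConjecture.Cruxes.H413.F0P3cStCharTSCharacterEllipticUniform
open Summit.HodgeConjecture.HodgeConjecture.Cruxes.H413.F0P3cStCharTSEPFunctionOrbitalOrbits
open Summit.HodgeConjecture.HodgeConjecture.Cruxes.H413.F0P3cStCharTSHorocyclesAtDatum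
open Summit.HodgeConjecture.HodgeConjecture.Cruxes.H413.F0P3cStCharTSTreeOrbitDataGqs
open Summit.HodgeConjecture.HodgeConjecture.Cruxes.H413.F0P3cStCharTSPrincipalSeriesLine

/-! ## §4 THE `h61` DISCHARGE: `tr i_G(χ)(f_EP) = 0` at the datum, from ★ 5b (`hEuler`) and ★ 61-G (`hm_q`) over the ★ 55-B packages and ★ 61-σ -/

section Discharge

variable (L : Type) [Field L] [NumberField L] [IsCMField L] (v : HeightOneSpectrum (𝓞 ↥(maximalRealSubfield L)))

set_option maxHeartbeats 800000 in
/-- **THE CARRIER BRIDGE ON MULTIPLICITIES** (★ 61-σ (β) `smoothIndRep_cmBorel_eq_cmPrincipalSeries`, isolated): the multiplicity of a `K`-type in `Ind_B^G σχ` read on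
`Gqs L v` IS its multiplicity in `cmPrincipalSeries L 3 v χ` — the one rewrite that moves ★ 61-G's output into ★ ED. 1 §3's currency, kept OUT of the assembly proof (the
`whnf` wall measured at > 3.2 M heartbeats when rewritten inside it). [cite: Rogawski1990, §12.2 p. 173] [cite: BernsteinZelevinsky1977, §2.3] -/
theorem finrank_intertwiningMap_smoothIndRep_cmBorel_eq (χ : ↥(cmBorelTriple L 3 v).M →* ℂˣ) {K : Subgroup (Gqs L v)} {E : Type*} [AddCommGroup E] [Module ℂ E]
    (τK : Representation ℂ K E) :
    haveI : LocallyCompactSpace ↥(cmBorelTriple L 3 v : ParabolicTriple (Gqs L v)).P := locallyCompactSpace_cmBorelU L 3 v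
    Module.finrank ℂ (Representation.IntertwiningMap τK ((Representation.smoothIndRep (cmBorelTriple L 3 v : ParabolicTriple (Gqs L v)).P
        (Representation.twist ((((Representation.trivial ℂ ↥(cmBorelTriple L 3 v : ParabolicTriple (Gqs L v)).M ℂ).twist χ).comp
          (cmBorelTriple L 3 v : ParabolicTriple (Gqs L v)).proj)) (rootDeltaChar (cmBorelTriple L 3 v : ParabolicTriple (Gqs L v)).P))).comp K.subtype)) =
      Module.finrank ℂ (Representation.IntertwiningMap τK ((UnitaryGroup.cmPrincipalSeries L 3 v χ : Representation ℂ (Gqs L v) _).comp K.subtype)) := by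
  exact congrArg (fun X : Representation ℂ (Gqs L v) _ => Module.finrank ℂ (Representation.IntertwiningMap τK (X.comp K.subtype)))
    (smoothIndRep_cmBorel_eq_cmPrincipalSeries L v χ)

set_option maxHeartbeats 3200000 in  -- measured: rc 1 at 1 600 000 (the `hS₁` Finset bookkeeping on the datum edge type); 132 s wall at 3 200 000 — the 41g-H ∕ 48-datum `whnf` wall
/-- **E1 ROW 61b — `tr i_G(χ)(f_EP) = 0` AT THE DATUM, UNCONDITIONALLY (the `h61` binder of the K1-UNR road, discharged).**  At an unramified non-split place `v` of `L⁺`, with the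
(G3)-EXPLICIT one-place model `(w hw ϖ hd eA heA)`, the tree letters of ★ 41g-H, the standard apartment `A` (★ 39γ) and the base edge `d₁ = {A 0, A 1}`, its three stabilisers
`P₀ = Stab(A 0)`, `P₂ = Stab(A 1)`, `P₁ = Stab(d₁)`: for EVERY smooth `ρ` with finite-dimensional Jacquet module and finite-dimensional `V^{U_q}` at the three facets, with `K`-types
`τ_q = ρ|_{P_q}` trivial on `U_q` and pieces `f_q = 𝟙_{P_q}·χ_{τ_q}(·⁻¹)`, and EVERY continuous character `χ` of `T(L⁺_v)`,
`tr i_G(χ)((ν P₀)⁻¹ • f₀ + (ν P₂)⁻¹ • f₂ − (ν P₁)⁻¹ • f₁) = 0` — ★ ED. 1 §3 with `hEuler` from ★ 5b at the datum and `hm₀ hm₂ hm₁` from ★ 61-G over ★ B-3a ∕ ★ B-3b ∕ ★ 61-σ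
(module docstring for the full supplier list).  Shape = cert v6's `h61` after `(w hw) {ϖ} (hd) (eA) (heA)` VERBATIM; its one use site pays `heA, A hA0 hA1, rfl, r.isSmooth,
(finrank_coinvariants_le_two L v hns r).1`. [cite: SchneiderStuhler1997, §III.4 Lemma III.4.18] [cite: Kottwitz1988, §2] [cite: Rogawski1990, §12.2 p. 173; §12.5 pp. 182–187]
[cite: BernsteinZelevinsky1977, §2.3, Thm 5.2] [cite: Casselman1995, §6.3] [cite: BruhatTits1972, (4.4.3)–(4.4.4), §10] -/
theorem smoothTrace_cmPrincipalSeries_epFunction_eq_zero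
    [MeasurableSpace (Gqs L v)] [BorelSpace (Gqs L v)] (νQv : Measure (Gqs L v)) [νQv.IsHaarMeasure]
    (w : PlacesOver L v) (hw : IsCMField.complexConj L • w.1 = w.1) {ϖ : (w.1.adicCompletion L)} (hd : UnramifiedLocalConjDatum (galAdicCompletionMap (L := L) (IsCMField.complexConj L) hw) ϖ)
    (eA : (Gqs L v) ≃ₜ* ↥(unitaryGroupOfForm (galAdicCompletionMap (L := L) (IsCMField.complexConj L) hw) ((StdForm.antidiagonal 3).over (w.1.adicCompletion L))))
    (heA : ∀ g : Gqs L v,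
      ((eA g : ↥(unitaryGroupOfForm (galAdicCompletionMap (L := L) (IsCMField.complexConj L) hw) ((StdForm.antidiagonal 3).over (w.1.adicCompletion L)))) :
          GL (Fin 3) (w.1.adicCompletion L)) =
        ((localNonsplitEquiv (IsCMField.complexConj L) (qsForm L) (IsCMField.complexConj_ne_one L) w hw g :
          ↥(unitaryGroupOfForm (galAdicCompletionMap (L := L) (IsCMField.complexConj L) hw) (placeForm (qsForm L) w.1))) : GL (Fin 3) (w.1.adicCompletion L)))
    {a : (Gqs L v) →* ((latticeGraph (galAdicCompletionMap (L := L) (IsCMField.complexConj L) hw) ϖ ((StdForm.antidiagonal 3).over (w.1.adicCompletion L))) ≃g (latticeGraph (galAdicCompletionMap (L := L) (IsCMField.complexConj L) hw) ϖ ((StdForm.antidiagonal 3).over (w.1.adicCompletion L))))} (ha : ∀ g, a g = latticeGraphIso (galAdicCompletionMap (L := L) (IsCMField.complexConj L) hw) ϖ ((StdForm.antidiagonal 3).over (w.1.adicCompletion L)) (eA g))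
    (τ : Orientation (latticeGraph (galAdicCompletionMap (L := L) (IsCMField.complexConj L) hw) ϖ ((StdForm.antidiagonal 3).over (w.1.adicCompletion L)))) (hτ : ∀ d, τ.tail d < τ.head d)
    {e : ℕ} {U : {M : Submodule 𝒪[(w.1.adicCompletion L)] (Fin 3 → (w.1.adicCompletion L)) // IsVertex (galAdicCompletionMap (L := L) (IsCMField.complexConj L) hw) ϖ ((StdForm.antidiagonal 3).over (w.1.adicCompletion L)) M} → Subgroup (Gqs L v)}
    (hU : ∀ x g, g ∈ U x ↔ mapGL ((eA g : ↥(unitaryGroupOfForm (galAdicCompletionMap (L := L) (IsCMField.complexConj L) hw) ((StdForm.antidiagonal 3).over (w.1.adicCompletion L)))) : GL (Fin 3) (w.1.adicCompletion L)) x.1 = x.1 ∧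
      x.1.map ((Matrix.toLin' ((((eA g : ↥(unitaryGroupOfForm (galAdicCompletionMap (L := L) (IsCMField.complexConj L) hw) ((StdForm.antidiagonal 3).over (w.1.adicCompletion L)))) : GL (Fin 3) (w.1.adicCompletion L)) : Matrix (Fin 3) (Fin 3) (w.1.adicCompletion L)) - 1)).restrictScalars 𝒪[(w.1.adicCompletion L)]) ≤ scaleLattice (ϖ ^ (e + 1)) x.1)
    (hUo : ∀ x, IsOpen (U x : Set (Gqs L v))) (hUc : ∀ x, IsCompact (U x : Set (Gqs L v)))
    (hEo : ∀ d : (latticeGraph (galAdicCompletionMap (L := L) (IsCMField.complexConj L) hw) ϖ ((StdForm.antidiagonal 3).over (w.1.adicCompletion L))).edgeSet, IsOpen ((U (τ.head d) ⊔ U (τ.tail d) : Subgroup (Gqs L v)) : Set (Gqs L v)))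
    (hEc : ∀ d : (latticeGraph (galAdicCompletionMap (L := L) (IsCMField.complexConj L) hw) ϖ ((StdForm.antidiagonal 3).over (w.1.adicCompletion L))).edgeSet, IsCompact ((U (τ.head d) ⊔ U (τ.tail d) : Subgroup (Gqs L v)) : Set (Gqs L v)))
    -- the standard apartment and the base edge `A 0 — A 1` on it
    {A : ℤ → {M : Submodule 𝒪[(w.1.adicCompletion L)] (Fin 3 → (w.1.adicCompletion L)) // IsVertex (galAdicCompletionMap (L := L) (IsCMField.complexConj L) hw) ϖ ((StdForm.antidiagonal 3).over (w.1.adicCompletion L)) M}}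
    (hA0 : ∀ c : ℤ, (A (2 * c)).1 = latt (Matrix.diagonal ![ϖ ^ c, (1 : w.1.adicCompletion L), ϖ ^ (-c)]))
    (hA1 : ∀ c : ℤ, (A (2 * c + 1)).1 = latt (Matrix.diagonal ![ϖ ^ (c + 1), (1 : w.1.adicCompletion L), ϖ ^ (-c)]))
    (d₁ : (latticeGraph (galAdicCompletionMap (L := L) (IsCMField.complexConj L) hw) ϖ ((StdForm.antidiagonal 3).over (w.1.adicCompletion L))).edgeSet)
    (hd₁ : (d₁ : Sym2 {M : Submodule 𝒪[(w.1.adicCompletion L)] (Fin 3 → (w.1.adicCompletion L)) // IsVertex (galAdicCompletionMap (L := L) (IsCMField.complexConj L) hw) ϖ ((StdForm.antidiagonal 3).over (w.1.adicCompletion L)) M}) = s(A 0, A 1))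
    (P₀ P₂ P₁ : Subgroup (Gqs L v))
    (hP₀ : ∀ g, g ∈ P₀ ↔ a g (τ.head d₁) = τ.head d₁) (hP₂ : ∀ g, g ∈ P₂ ↔ a g (τ.tail d₁) = τ.tail d₁) (hP₁ : ∀ g, g ∈ P₁ ↔ (a g).mapEdgeSet d₁ = d₁)
    {V : Type*} [AddCommGroup V] [Module ℂ V] (ρ : Representation ℂ (Gqs L v) V) (hρ : ρ.IsSmooth)
    (hVN : FiniteDimensional ℂ ((cmBorelTriple L 3 v).restrict ρ).Coinvariants)
    [FiniteDimensional ℂ ↥(ρ.fixedPoints (U (τ.head d₁)))] [FiniteDimensional ℂ ↥(ρ.fixedPoints (U (τ.tail d₁)))]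
    [FiniteDimensional ℂ ↥(ρ.fixedPoints (U (τ.head d₁) ⊔ U (τ.tail d₁)))]
    (τ₀ : Representation ℂ ↥P₀ ↥(ρ.fixedPoints (U (τ.head d₁))))
    (hτρ₀ : ∀ (p : ↥P₀) (x : ↥(ρ.fixedPoints (U (τ.head d₁)))), ((τ₀ p x : ↥(ρ.fixedPoints (U (τ.head d₁)))) : V) = ρ (p : (Gqs L v)) (x : V))
    (hτ₀ : ∀ p : ↥P₀, (p : (Gqs L v)) ∈ U (τ.head d₁) → τ₀ p = 1)
    (τ₂ : Representation ℂ ↥P₂ ↥(ρ.fixedPoints (U (τ.tail d₁))))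
    (hτρ₂ : ∀ (p : ↥P₂) (x : ↥(ρ.fixedPoints (U (τ.tail d₁)))), ((τ₂ p x : ↥(ρ.fixedPoints (U (τ.tail d₁)))) : V) = ρ (p : (Gqs L v)) (x : V))
    (hτ₂ : ∀ p : ↥P₂, (p : (Gqs L v)) ∈ U (τ.tail d₁) → τ₂ p = 1)
    (τ₁ : Representation ℂ ↥P₁ ↥(ρ.fixedPoints (U (τ.head d₁) ⊔ U (τ.tail d₁))))
    (hτρ₁ : ∀ (p : ↥P₁) (x : ↥(ρ.fixedPoints (U (τ.head d₁) ⊔ U (τ.tail d₁)))), ((τ₁ p x : ↥(ρ.fixedPoints (U (τ.head d₁) ⊔ U (τ.tail d₁)))) : V) = ρ (p : (Gqs L v)) (x : V))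
    (hτ₁ : ∀ p : ↥P₁, (p : (Gqs L v)) ∈ U (τ.head d₁) ⊔ U (τ.tail d₁) → τ₁ p = 1)
    {f₀ f₂ f₁ : (Gqs L v) → ℂ}
    (hfP₀ : ∀ (g : (Gqs L v)) (hg : g ∈ P₀), f₀ g = Representation.character τ₀ ⟨g, hg⟩⁻¹) (hf0₀ : ∀ g ∉ P₀, f₀ g = 0)
    (hfP₂ : ∀ (g : (Gqs L v)) (hg : g ∈ P₂), f₂ g = Representation.character τ₂ ⟨g, hg⟩⁻¹) (hf0₂ : ∀ g ∉ P₂, f₂ g = 0)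
    (hfP₁ : ∀ (g : (Gqs L v)) (hg : g ∈ P₁), f₁ g = Representation.character τ₁ ⟨g, hg⟩⁻¹) (hf0₁ : ∀ g ∉ P₁, f₁ g = 0)
    (χ : ↥(cmBorelTriple L 3 v).M →* ℂˣ) (hχ : Continuous fun t => ((χ t : ℂˣ) : ℂ)) :
    Representation.smoothTrace (G := Gqs L v) (UnitaryGroup.cmPrincipalSeries L 3 v χ) νQv
        ((((νQv.real (P₀ : Set (Gqs L v)))⁻¹ : ℂ)) • f₀ + (((νQv.real (P₂ : Set (Gqs L v)))⁻¹ : ℂ)) • f₂ - (((νQv.real (P₁ : Set (Gqs L v)))⁻¹ : ℂ)) • f₁) = 0 := by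
  classical
  haveI : NonarchimedeanGroup (Gqs L v) :=
    nonarchimedeanGroup_unitaryGroupOfForm_local (E := L) (c := IsCMField.complexConj L) (N := 3) (v := v) (J' := (adelicForm L 3 (qsForm L)).map (adeleToLocal L v))
  -- §A the tree axioms at the datum (★ 41g-H §2)
  have hT := isTree_latticeGraph_three_of_unramified hd
  have hσa : ∀ (g : Gqs L v) (d : (latticeGraph (galAdicCompletionMap (L := L) (IsCMField.complexConj L) hw) ϖ ((StdForm.antidiagonal 3).over (w.1.adicCompletion L))).edgeSet),
      τ.head ((a g).mapEdgeSet d) = a g (τ.head d) ∧ τ.tail ((a g).mapEdgeSet d) = a g (τ.tail d) := fun g d => by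
    rw [ha]; exact head_mapEdgeSet_latticeGraphIso (galAdicCompletionMap (L := L) (IsCMField.complexConj L) hw) ϖ ((StdForm.antidiagonal 3).over (w.1.adicCompletion L)) hτ (eA g) d
  have hstab := isOpen_setOf_actionHom_apply_eq (L := L) (v := v) (w := w) (hw := hw) (eA := eA) ha
  have hU6 := fun x y (hxy : (latticeGraph (galAdicCompletionMap (L := L) (IsCMField.complexConj L) hw) ϖ ((StdForm.antidiagonal 3).over (w.1.adicCompletion L))).Adj x y) =>
    coe_sup_unitaryLevel_gqs_eq_mul_of_adj (eA := eA) hU hd hxy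
  have hU7 := fun x y z (hxy : (latticeGraph (galAdicCompletionMap (L := L) (IsCMField.complexConj L) hw) ϖ ((StdForm.antidiagonal 3).over (w.1.adicCompletion L))).Adj x y)
      (hyz : (latticeGraph (galAdicCompletionMap (L := L) (IsCMField.complexConj L) hw) ϖ ((StdForm.antidiagonal 3).over (w.1.adicCompletion L))).dist y z + 1 =
        (latticeGraph (galAdicCompletionMap (L := L) (IsCMField.complexConj L) hw) ϖ ((StdForm.antidiagonal 3).over (w.1.adicCompletion L))).dist x z) =>
    coe_unitaryLevel_gqs_subset_mul_of_adj_of_dist (eA := eA) hU hd hxy hyz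
  have hUa := unitaryLevel_gqs_actionHom_eq_map_conj (eA := eA) ha hU
  -- §B the base edge is the apartment edge: `τ.head d₁ = A 0`, `τ.tail d₁ = A 1` (heads have type `0`, ★ `type_of_lt_three`)
  have hϖ1 : Valued.v ϖ ≤ 1 := v_le_one_of_v_eq_exp_neg_one hd.vϖ
  have hϖ0 : ϖ ≠ 0 := CartanUnique.uniformizer_ne_zero hd.vϖ
  have hJ : Valued.v (((StdForm.antidiagonal 3).over (w.1.adicCompletion L))).det = 1 := v_det_antidiagonal_three
  have hAinj := apartmentEnum_injective hd A hA0 hA1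
  have hsd0 : IsVertexLattice (galAdicCompletionMap (L := L) (IsCMField.complexConj L) hw) ϖ ((StdForm.antidiagonal 3).over (w.1.adicCompletion L)) 0 (A 0).1 := by
    have h := hA0 0
    rw [show (2 : ℤ) * 0 = 0 from rfl] at h
    rw [h]
    exact isSelfDualLattice_latt_diagonal_zpow hd.σσ hd.σϖ hϖ1 hϖ0 0
  have hd₁A : τ.head d₁ = A 0 ∧ τ.tail d₁ = A 1 := by
    have hm0 : A 0 ∈ (d₁ : Sym2 _) := by rw [hd₁]; exact Sym2.mem_mk_left _ _
    have hm1 : A 1 ∈ (d₁ : Sym2 _) := by rw [hd₁]; exact Sym2.mem_mk_right _ _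
    have h01 : A 0 ≠ A 1 := fun h => by have := hAinj h; omega
    rcases τ.mem_iff.1 hm0 with h0 | h0
    · refine ⟨h0.symm, ?_⟩
      rcases τ.mem_iff.1 hm1 with h1 | h1
      · exact absurd (h0.trans h1.symm) h01
      · exact h1.symm
    · exfalso
      obtain ⟨k₀, hk₀⟩ := (τ.head d₁).2
      have hsd : IsVertexLattice (galAdicCompletionMap (L := L) (IsCMField.complexConj L) hw) ϖ ((StdForm.antidiagonal 3).over (w.1.adicCompletion L)) 0 (τ.tail d₁).1 := by
        rw [← h0]; exact hsd0
      have h2 := (type_of_lt_three hd.vσ hd.vϖ hJ hsd hk₀ (Subtype.coe_lt_coe.2 (hτ d₁))).1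
      omega
  have hde : d₁ = ⟨s(A 0, A (0 + 1)), (SimpleGraph.mem_edgeSet _).2 (latticeGraph_adj_apartmentEnum_succ hd A hA0 hA1 0)⟩ :=
    Subtype.ext (show (d₁ : Sym2 _) = s(A 0, A (0 + 1)) by rw [hd₁]; norm_num)
  obtain ⟨hhd, htl⟩ := hd₁A
  have hP₁e : ∀ g, g ∈ P₁ ↔ (a g).mapEdgeSet (⟨s(A 0, A (0 + 1)), (SimpleGraph.mem_edgeSet _).2 (latticeGraph_adj_apartmentEnum_succ hd A hA0 hA1 0)⟩ : (latticeGraph (galAdicCompletionMap (L := L) (IsCMField.complexConj L) hw) ϖ ((StdForm.antidiagonal 3).over (w.1.adicCompletion L))).edgeSet) =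
      ⟨s(A 0, A (0 + 1)), (SimpleGraph.mem_edgeSet _).2 (latticeGraph_adj_apartmentEnum_succ hd A hA0 hA1 0)⟩ := fun g => by rw [hP₁, hde]
  have hP₀' : ∀ g, g ∈ P₀ ↔ a g (A 0) = A 0 := fun g => by rw [hP₀, hhd]
  have hP₂' : ∀ g, g ∈ P₂ ↔ a g (A 1) = A 1 := fun g => by rw [hP₂, htl]
  -- §C the Borel triple, the torus translation (★ B-1 (X0)), the horocycle data (★ B-2), the compact torus `C = T ∩ Stab(A 0)`
  have hN := UnitaryGroup.isLimitOfCompactOpen_cmBorelTriple_N L 3 v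
  obtain ⟨τM, hτM, -, hτA⟩ := exists_mem_cmBorelTriple_M_apartmentEnum_eq_add_two L v w hw hd eA heA ha A hA0 hA1
  obtain ⟨rep₀, tr₀, ht₀, htrN₀, hrepR₀, htr₀, hrep_act₀, hrep_id₀, hsh₀, hsh₀', hCR₀, hS₀⟩ :=
    exists_horocycleData_vertices L v w hw hd eA heA ha A hA0 hA1 P₀ hP₀' τM hτA
  obtain ⟨rep₁, tr₁, ht₁, htrN₁, hrepR₁, htr₁, hrep_act₁, hrep_id₁, hsh₁, hsh₁', hCR₁, hS₁⟩ :=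
    exists_horocycleData_edges L v w hw hd eA heA ha A hA0 hA1 P₀ hP₀' τM hτA
  have hC : IsCompact ((((cmBorelTriple L 3 v : ParabolicTriple (Gqs L v)).M ⊓ P₀ : Subgroup (Gqs L v)) : Set (Gqs L v))) :=
    isCompact_cmBorelTriple_M_inf L v w hw eA heA ha P₀ (A 0) hP₀'
  have hCτ : ∀ c : Gqs L v, c ∈ (cmBorelTriple L 3 v : ParabolicTriple (Gqs L v)).M ⊓ P₀ → c * τM = τM * c := fun c hc =>
    mul_comm_of_mem_cmBorelTriple_M L v w hw eA heA (Subgroup.mem_inf.1 hc).1 hτM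
  have hCP : (cmBorelTriple L 3 v : ParabolicTriple (Gqs L v)).M ⊓ P₀ ≤ (cmBorelTriple L 3 v : ParabolicTriple (Gqs L v)).P :=
    inf_le_left.trans (cmBorelTriple L 3 v : ParabolicTriple (Gqs L v)).M_le
  -- §D the inducing character `χ̃ = δ_B^{1/2} · (χ ∘ proj)` of `B`, its restriction to `C`, open kernels
  haveI := locallyCompactSpace_cmBorelU L 3 v
  haveI : NonarchimedeanGroup ↥(unitaryGroupOfForm (conjLocal L (IsCMField.complexConj L) v) (cmLocalForm L 3 v)) := ‹NonarchimedeanGroup (Gqs L v)›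
  letI : MeasurableSpace ↥(cmBorelTriple L 3 v : ParabolicTriple (Gqs L v)).P := borel _
  haveI : BorelSpace ↥(cmBorelTriple L 3 v : ParabolicTriple (Gqs L v)).P := ⟨rfl⟩
  obtain ⟨χH, hχH⟩ : ∃ χH : ↥(cmBorelTriple L 3 v : ParabolicTriple (Gqs L v)).P →* ℂˣ,
      ∀ b, χH b = rootDeltaChar (cmBorelTriple L 3 v : ParabolicTriple (Gqs L v)).P b * χ ((cmBorelTriple L 3 v : ParabolicTriple (Gqs L v)).proj b) :=
    ⟨rootDeltaChar (cmBorelTriple L 3 v : ParabolicTriple (Gqs L v)).P * χ.comp (cmBorelTriple L 3 v : ParabolicTriple (Gqs L v)).proj, fun b => rfl⟩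
  have hχHc : Continuous fun b : ↥(cmBorelTriple L 3 v : ParabolicTriple (Gqs L v)).P => ((χH b : ℂˣ) : ℂ) := by
    simp only [hχH, Units.val_mul]
    exact (continuous_rootDeltaChar_unitsCoe' (cmBorelTriple L 3 v : ParabolicTriple (Gqs L v)).P).mul
      (continuous_apply_proj_borelTriple (conjLocal L (IsCMField.complexConj L) v) (cmLocalForm L 3 v) (cmLocalForm_eq_over L 3 v) χ hχ)
  have hχHo : IsOpen (χH.ker : Set ↥(cmBorelTriple L 3 v : ParabolicTriple (Gqs L v)).P) :=
    Representation.isOpen_ker_of_continuous_coe _ χH hχHc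
  obtain ⟨χC, hχC⟩ : ∃ χC : ↥((cmBorelTriple L 3 v : ParabolicTriple (Gqs L v)).M ⊓ P₀) →* ℂˣ, ∀ c, χC c = χH (Subgroup.inclusion hCP c) :=
    ⟨χH.comp (Subgroup.inclusion hCP), fun c => rfl⟩
  have hχCo : IsOpen (χC.ker : Set ↥((cmBorelTriple L 3 v : ParabolicTriple (Gqs L v)).M ⊓ P₀)) := by
    refine Representation.isOpen_ker_of_continuous_coe _ χC ?_
    simp only [hχC]
    exact hχHc.comp (continuous_inclusion hCP)
  -- §E the Schneider–Stuhler complex of `ρ` on the whole tree (★ 41d-II, ★ 5a), finiteness of every `V^{U_x}` and of `(V|_X)_N`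
  obtain ⟨τc, hτc⟩ := Representation.exists_rep_zeroChains a ρ
  obtain ⟨τc₁, hτc₁⟩ := Representation.exists_rep_oneChains a ρ
  obtain ⟨ρ₁, ρ₀, ρV, hρ₁, hρ₀, hρV⟩ := Representation.exists_reps_univ hτc hτc₁ τ U hUa hσa
  obtain ⟨D, hD⟩ := Representation.exists_boundaryMap (k := ℂ) (V := V) τ
  obtain ⟨E, hE⟩ := Representation.exists_augmentationMap (k := ℂ) (V := V)
    (ι := {M : Submodule 𝒪[(w.1.adicCompletion L)] (Fin 3 → (w.1.adicCompletion L)) // IsVertex (galAdicCompletionMap (L := L) (IsCMField.complexConj L) hw) ϖ ((StdForm.antidiagonal 3).over (w.1.adicCompletion L)) M})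
  have hfd : ∀ x, FiniteDimensional ℂ ↥(ρ.fixedPoints (U x)) := fun x => by
    rcases mem_headOrbit_or_mem_tailOrbit L v w hw hd eA ha τ hτ d₁ x with ⟨g, hg⟩ | ⟨g, hg⟩
    · rw [← hg, ← Representation.map_fixedPoints_eq_fixedPoints_act hUa g (τ.head d₁)]
      infer_instance
    · rw [← hg, ← Representation.map_fixedPoints_eq_fixedPoints_act hUa g (τ.tail d₁)]
      infer_instance
  obtain ⟨ιV, hιV⟩ : ∃ ιV : ρV.IntertwiningMap ρ, ∀ x, ιV x = (x : V) :=
    ⟨⟨Submodule.subtype _, fun g => LinearMap.ext fun x => hρV g x⟩, fun x => rfl⟩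
  have hιVinj : Function.Injective ιV := fun x y h => Subtype.ext (by rwa [hιV, hιV] at h)
  haveI hVN' : FiniteDimensional ℂ ((cmBorelTriple L 3 v : ParabolicTriple (Gqs L v)).restrict ρV).Coinvariants :=
    haveI := hVN
    Module.Finite.of_injective (Representation.jacquetMap (cmBorelTriple L 3 v : ParabolicTriple (Gqs L v)) ιV).toLinearMap
      (UnitaryGroup.jacquetMap_cmBorel_injective L 3 v hρ ιV hιVinj)
  -- §F the `χ̃`-eigenspaces of the compact torus in the three Jacquet modules (★ M3) and the JACQUET EULER IDENTITY (★ 5b)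
  have hCM : (cmBorelTriple L 3 v : ParabolicTriple (Gqs L v)).M ⊓ P₀ ≤ (cmBorelTriple L 3 v : ParabolicTriple (Gqs L v)).M := inf_le_left
  obtain ⟨E₁, hE₁⟩ := Representation.exists_eigenSubmodule
    (fun c : ↥((cmBorelTriple L 3 v : ParabolicTriple (Gqs L v)).M ⊓ P₀) =>
      (ρ₁.jacquetModule (cmBorelTriple L 3 v : ParabolicTriple (Gqs L v)) ⟨c.1, hCM c.2⟩ : _ →ₗ[ℂ] _))
    (fun c => ((χC c : ℂˣ) : ℂ))
  obtain ⟨E₀, hE₀⟩ := Representation.exists_eigenSubmodule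
    (fun c : ↥((cmBorelTriple L 3 v : ParabolicTriple (Gqs L v)).M ⊓ P₀) =>
      (ρ₀.jacquetModule (cmBorelTriple L 3 v : ParabolicTriple (Gqs L v)) ⟨c.1, hCM c.2⟩ : _ →ₗ[ℂ] _))
    (fun c => ((χC c : ℂˣ) : ℂ))
  obtain ⟨EV, hEV⟩ := Representation.exists_eigenSubmodule
    (fun c : ↥((cmBorelTriple L 3 v : ParabolicTriple (Gqs L v)).M ⊓ P₀) =>
      (ρV.jacquetModule (cmBorelTriple L 3 v : ParabolicTriple (Gqs L v)) ⟨c.1, hCM c.2⟩ : _ →ₗ[ℂ] _))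
    (fun c => ((χC c : ℂˣ) : ℂ))
  have hS₀f : ∀ r, r ∈ ({A 0, A 1} : Finset _) ↔ r ∈ Set.range A ∧ ht₀ r = 0 := fun r =>
    (Finset.mem_insert.trans (or_congr Iff.rfl Finset.mem_singleton)).trans (hS₀ r).symm
  have hS₁f : ∀ r, r ∈ ({(⟨s(A 0, A (0 + 1)), (SimpleGraph.mem_edgeSet _).2 (latticeGraph_adj_apartmentEnum_succ hd A hA0 hA1 0)⟩ : (latticeGraph (galAdicCompletionMap (L := L) (IsCMField.complexConj L) hw) ϖ ((StdForm.antidiagonal 3).over (w.1.adicCompletion L))).edgeSet),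
      (⟨s(A 1, A (1 + 1)), (SimpleGraph.mem_edgeSet _).2 (latticeGraph_adj_apartmentEnum_succ hd A hA0 hA1 1)⟩ : (latticeGraph (galAdicCompletionMap (L := L) (IsCMField.complexConj L) hw) ϖ ((StdForm.antidiagonal 3).over (w.1.adicCompletion L))).edgeSet)} : Finset _) ↔
      r ∈ (Set.range fun j : ℤ => (⟨s(A j, A (j + 1)), (SimpleGraph.mem_edgeSet _).2 (latticeGraph_adj_apartmentEnum_succ hd A hA0 hA1 j)⟩ : (latticeGraph (galAdicCompletionMap (L := L) (IsCMField.complexConj L) hw) ϖ ((StdForm.antidiagonal 3).over (w.1.adicCompletion L))).edgeSet)) ∧ ht₁ r = 0 := fun r =>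
    (Finset.mem_insert.trans (or_congr Iff.rfl Finset.mem_singleton)).trans (hS₁ r).symm
  have hEuler := Representation.sum_finrank_block_eigen_eq_of_tree hτc hτc₁ hT τ U hUc hUo hU6 hU7 hUa hσa hstab hρ hfd hD hE hρ₁ hρ₀ hρV
    (cmBorelTriple L 3 v : ParabolicTriple (Gqs L v)) hN rep₁ tr₁ htrN₁ hrepR₁ htr₁ hrep_act₁ hrep_id₁ ht₁ rep₀ tr₀ htrN₀ hrepR₀ htr₀ hrep_act₀ hrep_id₀ ht₀
    hτM hsh₁ hsh₁' hsh₀ hsh₀' hVN' ((cmBorelTriple L 3 v : ParabolicTriple (Gqs L v)).M ⊓ P₀) hCM hC hCτ hCR₁ hCR₀ χC hχCo hE₁ hE₀ hEV _ hS₁f _ hS₀f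
  -- §G THE THREE BLOCKWISE MULTIPLICITIES (★ 61-G over ★ B-3a ∕ ★ B-3b and ★ 61-σ)
  -- the inducing line
  have hσχ : ∀ (h : ↥(cmBorelTriple L 3 v : ParabolicTriple (Gqs L v)).P) (z : ℂ),
      Representation.twist ((((Representation.trivial ℂ ↥(cmBorelTriple L 3 v : ParabolicTriple (Gqs L v)).M ℂ).twist χ).comp
        (cmBorelTriple L 3 v : ParabolicTriple (Gqs L v)).proj)) (rootDeltaChar (cmBorelTriple L 3 v : ParabolicTriple (Gqs L v)).P) h z = ((χH h : ℂˣ) : ℂ) • z :=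
    fun h z => by rw [hχH]; exact cmBorel_line_apply L v χ h z
  have hNχ : ∀ (n : Gqs L v) (hn : n ∈ (cmBorelTriple L 3 v : ParabolicTriple (Gqs L v)).P), n ∈ (cmBorelTriple L 3 v : ParabolicTriple (Gqs L v)).N → χH ⟨n, hn⟩ = 1 :=
    fun n hn hnN => by rw [hχH]; exact cmBorel_lineChar_eq_one_of_mem_N L v χ n hn hnN
  have hW1 : Module.finrank ℂ ℂ = 1 := Module.finrank_self ℂ
  have hχC' : ∀ c : ↥((cmBorelTriple L 3 v : ParabolicTriple (Gqs L v)).M ⊓ P₀),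
      ((χC c : ℂˣ) : ℂ) = ((χH ⟨c.1, (cmBorelTriple L 3 v : ParabolicTriple (Gqs L v)).M_le (hCM c.2)⟩ : ℂˣ) : ℂ) := fun c => by
    rw [hχC]; rfl
  -- stabilisers: `U_q ≤ P_q`, openness, smoothness of the `K`-types (★ 61-σ)
  have hUP₀ : U (τ.head d₁) ≤ P₀ := fun u hu => (hP₀ u).2 (actionHom_apply_eq_of_mem ha hU hu)
  have hUP₂ : U (τ.tail d₁) ≤ P₂ := fun u hu => (hP₂ u).2 (actionHom_apply_eq_of_mem ha hU hu)
  have hfixE := mapEdgeSet_eq_iff L v w hw eA ha τ hτ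
  have hadj₁ := τ.adj_head_tail d₁
  have hUP₁ : U (τ.head d₁) ⊔ U (τ.tail d₁) ≤ P₁ :=
    sup_le (fun u hu => (hP₁ u).2 ((hfixE u d₁).2 ⟨actionHom_apply_eq_of_mem ha hU hu, actionHom_apply_eq_of_mem_of_adj ha hU hd hu hadj₁⟩))
      (fun u hu => (hP₁ u).2 ((hfixE u d₁).2 ⟨actionHom_apply_eq_of_mem_of_adj ha hU hd hu hadj₁.symm, actionHom_apply_eq_of_mem ha hU hu⟩))
  have hP₀o : IsOpen (P₀ : Set (Gqs L v)) := by rw [Set.ext hP₀]; exact hstab _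
  have hP₂o : IsOpen (P₂ : Set (Gqs L v)) := by rw [Set.ext hP₂]; exact hstab _
  have hP₁o : IsOpen (P₁ : Set (Gqs L v)) := Subgroup.isOpen_mono hUP₁ (hEo d₁)
  have hτsm₀ : τ₀.IsSmooth := isSmooth_of_apply_eq_one_of_le hUP₀ (hUo _) τ₀ fun u hu => hτ₀ ⟨u, hUP₀ hu⟩ hu
  have hτsm₂ : τ₂.IsSmooth := isSmooth_of_apply_eq_one_of_le hUP₂ (hUo _) τ₂ fun u hu => hτ₂ ⟨u, hUP₂ hu⟩ hu
  have hτsm₁ : τ₁.IsSmooth := isSmooth_of_apply_eq_one_of_le hUP₁ (hEo d₁) τ₁ fun u hu => hτ₁ ⟨u, hUP₁ hu⟩ hu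
  -- (X3)(X4): the three Borel double-coset packages (★ B-3a at `A 0`, `A 1`; ★ B-3b at the Iwahori)
  obtain ⟨hcov₀, hdj₀, hT₀, hdec₀, hC₀⟩ := borelDoubleCoset_vertex L v w hw hd eA heA ha A hA0 hA1 (cmBorelTriple L 3 v : ParabolicTriple (Gqs L v)) rfl τM hτM hτA
    (Or.inl rfl) P₀ P₀ hP₀' hP₀'
  obtain ⟨hcov₂, hdj₂, hT₂, hdec₂, hC₂⟩ := borelDoubleCoset_vertex L v w hw hd eA heA ha A hA0 hA1 (cmBorelTriple L 3 v : ParabolicTriple (Gqs L v)) rfl τM hτM hτA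
    (Or.inr rfl) P₀ P₂ hP₀' hP₂'
  obtain ⟨hcov₁, hdj₁, hT₁, hdec₁, hC₁⟩ := borelDoubleCoset_edge L v w hw hd eA heA ha A hA0 hA1 (cmBorelTriple L 3 v : ParabolicTriple (Gqs L v)) rfl τM hτM hτA
    P₀ P₁ hP₀' hP₁e
  obtain ⟨-, hCT₁, hr₁e⟩ := borelDoubleCoset_edge_dock L v w hw hd eA heA ha A hA0 hA1 (cmBorelTriple L 3 v : ParabolicTriple (Gqs L v)) rfl τM hτA P₀ P₁ hP₀' hP₁e
  have hr₁ : ∀ i : Fin 2, (a (![(1 : Gqs L v), τM * eA.symm (weylLongU (galAdicCompletionMap (L := L) (IsCMField.complexConj L) hw) rfl)] i)).mapEdgeSet d₁ ∈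
      (Set.range fun j : ℤ => (⟨s(A j, A (j + 1)), (SimpleGraph.mem_edgeSet _).2 (latticeGraph_adj_apartmentEnum_succ hd A hA0 hA1 j)⟩ : (latticeGraph (galAdicCompletionMap (L := L) (IsCMField.complexConj L) hw) ϖ ((StdForm.antidiagonal 3).over (w.1.adicCompletion L))).edgeSet)) :=
    fun i => by rw [hde]; exact hr₁e i
  have hCT₀ : ∀ _ : Unit, ((cmBorelTriple L 3 v : ParabolicTriple (Gqs L v)).M ⊓ P₀ : Subgroup (Gqs L v)) ≤ (cmBorelTriple L 3 v : ParabolicTriple (Gqs L v)).P ⊓ P₀ :=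
    fun _ c hc => Subgroup.mem_inf.2 ⟨(cmBorelTriple L 3 v : ParabolicTriple (Gqs L v)).M_le (Subgroup.mem_inf.1 hc).1, (Subgroup.mem_inf.1 hc).2⟩
  have hCT₂ : ∀ _ : Unit, ((cmBorelTriple L 3 v : ParabolicTriple (Gqs L v)).M ⊓ P₀ : Subgroup (Gqs L v)) ≤ (cmBorelTriple L 3 v : ParabolicTriple (Gqs L v)).P ⊓ P₂ :=
    fun _ c hc => Subgroup.mem_inf.2 ⟨(cmBorelTriple L 3 v : ParabolicTriple (Gqs L v)).M_le (Subgroup.mem_inf.1 hc).1,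
      (hP₂' c).2 (apartmentEnum_eq_self_of_mem_cmBorelTriple_M_of_apply_zero L v w hw hd eA heA ha A hA0 hA1 (Subgroup.mem_inf.1 hc).1 ((hP₀' c).1 (Subgroup.mem_inf.1 hc).2) 1)⟩
  have hone : ∀ x : {M : Submodule 𝒪[(w.1.adicCompletion L)] (Fin 3 → (w.1.adicCompletion L)) // IsVertex (galAdicCompletionMap (L := L) (IsCMField.complexConj L) hw) ϖ ((StdForm.antidiagonal 3).over (w.1.adicCompletion L)) M},
      a 1 x = x := fun x => by rw [map_one]; rfl
  have hr₀ : ∀ _ : Unit, a ((fun _ : Unit => (1 : Gqs L v)) ()) (τ.head d₁) ∈ Set.range A :=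
    fun _ => ⟨0, by rw [hone, hhd]⟩
  have hr₂ : ∀ _ : Unit, a ((fun _ : Unit => (1 : Gqs L v)) ()) (τ.tail d₁) ∈ Set.range A :=
    fun _ => ⟨1, by rw [hone, htl]⟩
  -- ★ 61-G, three times
  have hm₀ := Representation.finrank_intertwiningMap_smoothIndRep_eq_sum_block_eigen_zeroChains hτc U hUa hρ hfd hρ₀
    (cmBorelTriple L 3 v : ParabolicTriple (Gqs L v)) _ χH hσχ hχHo hNχ hW1 (τ.head d₁) P₀ hP₀ hP₀o τ₀ hτρ₀ hτsm₀
    (fun _ : Unit => (1 : Gqs L v)) hcov₀ hdj₀ (fun _ => (cmBorelTriple L 3 v : ParabolicTriple (Gqs L v)).P ⊓ P₀) hT₀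
    ((cmBorelTriple L 3 v : ParabolicTriple (Gqs L v)).M ⊓ P₀) hCM hCT₀ hdec₀ hC₀ rep₀ tr₀ htrN₀ htr₀ hrep_act₀ hrep_id₀ hr₀ χC hχC' hE₀
  have hm₂ := Representation.finrank_intertwiningMap_smoothIndRep_eq_sum_block_eigen_zeroChains hτc U hUa hρ hfd hρ₀
    (cmBorelTriple L 3 v : ParabolicTriple (Gqs L v)) _ χH hσχ hχHo hNχ hW1 (τ.tail d₁) P₂ hP₂ hP₂o τ₂ hτρ₂ hτsm₂
    (fun _ : Unit => (1 : Gqs L v)) hcov₂ hdj₂ (fun _ => (cmBorelTriple L 3 v : ParabolicTriple (Gqs L v)).P ⊓ P₂) hT₂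
    ((cmBorelTriple L 3 v : ParabolicTriple (Gqs L v)).M ⊓ P₀) hCM hCT₂ hdec₂ hC₂ rep₀ tr₀ htrN₀ htr₀ hrep_act₀ hrep_id₀ hr₂ χC hχC' hE₀
  have hfd₁ : ∀ e : (latticeGraph (galAdicCompletionMap (L := L) (IsCMField.complexConj L) hw) ϖ ((StdForm.antidiagonal 3).over (w.1.adicCompletion L))).edgeSet,
      FiniteDimensional ℂ ↥(ρ.fixedPoints (U (τ.head e) ⊔ U (τ.tail e))) := fun e =>
    haveI := hfd (τ.head e)
    Submodule.finiteDimensional_of_le (fun v hv => (Representation.mem_fixedPoints _ _ _).2 fun u hu => (Representation.mem_fixedPoints _ _ _).1 hv u (Subgroup.mem_sup_left hu))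
  have hm₁ := Representation.finrank_intertwiningMap_smoothIndRep_eq_sum_block_eigen_oneChains hτc₁ τ U hUa hσa hρ hfd₁ hρ₁
    (cmBorelTriple L 3 v : ParabolicTriple (Gqs L v)) _ χH hσχ hχHo hNχ hW1 d₁ P₁ hP₁ hP₁o τ₁ hτρ₁ hτsm₁
    _ hcov₁ hdj₁ _ hT₁ ((cmBorelTriple L 3 v : ParabolicTriple (Gqs L v)).M ⊓ P₀) hCM hCT₁ hdec₁ hC₁ rep₁ tr₁ htrN₁ htr₁ hrep_act₁ hrep_id₁ hr₁ χC hχC' hE₁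
  -- §H the carrier bridge (★ 61-σ (β), `rfl` isolated) and ★ ED. 1 §3
  replace hm₀ := (finrank_intertwiningMap_smoothIndRep_cmBorel_eq L v χ τ₀).symm.trans hm₀
  replace hm₂ := (finrank_intertwiningMap_smoothIndRep_cmBorel_eq L v χ τ₂).symm.trans hm₂
  replace hm₁ := (finrank_intertwiningMap_smoothIndRep_cmBorel_eq L v χ τ₁).symm.trans hm₁
  have h01 : A 0 ≠ A 1 := fun h => by have := hAinj h; omega
  have hE1 := mapEdgeSet_tau_weylLong_apartmentEnum_zero L v w hw hd eA ha A hA0 hA1 τM hτA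
  have he01 : (⟨s(A 0, A (0 + 1)), (SimpleGraph.mem_edgeSet _).2 (latticeGraph_adj_apartmentEnum_succ hd A hA0 hA1 0)⟩ : (latticeGraph (galAdicCompletionMap (L := L) (IsCMField.complexConj L) hw) ϖ ((StdForm.antidiagonal 3).over (w.1.adicCompletion L))).edgeSet) ≠
      ⟨s(A 1, A (1 + 1)), (SimpleGraph.mem_edgeSet _).2 (latticeGraph_adj_apartmentEnum_succ hd A hA0 hA1 1)⟩ := by
    intro h
    have h' : s(A 0, A (0 + 1)) = s(A 1, A (1 + 1)) := congrArg Subtype.val h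
    have hmem : A 0 ∈ s(A 1, A (1 + 1)) := by rw [← h']; exact Sym2.mem_mk_left _ _
    rcases Sym2.mem_iff.1 hmem with h0 | h0
    · exact h01 h0
    · have := hAinj h0; omega
  -- the two Mackey edge representatives land on `e₀`, `e₁`
  have hg0 : (a (![(1 : Gqs L v), τM * eA.symm (weylLongU (galAdicCompletionMap (L := L) (IsCMField.complexConj L) hw) rfl)] 0)).mapEdgeSet d₁ =
      ⟨s(A 0, A (0 + 1)), (SimpleGraph.mem_edgeSet _).2 (latticeGraph_adj_apartmentEnum_succ hd A hA0 hA1 0)⟩ := by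
    rw [Matrix.cons_val_zero, hde]; exact mapEdgeSet_actionHom_one L v w hw eA ha _
  have hg1 : (a (![(1 : Gqs L v), τM * eA.symm (weylLongU (galAdicCompletionMap (L := L) (IsCMField.complexConj L) hw) rfl)] 1)).mapEdgeSet d₁ =
      ⟨s(A 1, A (1 + 1)), (SimpleGraph.mem_edgeSet _).2 (latticeGraph_adj_apartmentEnum_succ hd A hA0 hA1 1)⟩ := by
    rw [Matrix.cons_val_one, Matrix.cons_val_zero, hde]; exact hE1
  refine smoothTrace_cmPrincipalSeries_epFunction_eq_zero_of_blockSums L v w hw hd eA ha νQv τ hτ hU hUo hUc hEo hEc d₁ P₀ P₂ P₁ hP₀ hP₂ hP₁ ρ τ₀ hτ₀ τ₂ hτ₂ τ₁ hτ₁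
    hfP₀ hf0₀ hfP₂ hf0₂ hfP₁ hf0₁ χ _ _ (fun _ : Unit => a (1 : Gqs L v) (τ.head d₁)) (fun _ : Unit => a (1 : Gqs L v) (τ.tail d₁))
    (fun i : Fin 2 => (a (![(1 : Gqs L v), τM * eA.symm (weylLongU (galAdicCompletionMap (L := L) (IsCMField.complexConj L) hw) rfl)] i)).mapEdgeSet d₁)
    hm₀ hm₂ hm₁ {A 0, A 1} (fun b => ?_) (fun _ _ _ => Subsingleton.elim _ _) (fun _ _ _ => Subsingleton.elim _ _) (fun _ _ => ?_)
    {⟨s(A 0, A (0 + 1)), (SimpleGraph.mem_edgeSet _).2 (latticeGraph_adj_apartmentEnum_succ hd A hA0 hA1 0)⟩,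
      ⟨s(A 1, A (1 + 1)), (SimpleGraph.mem_edgeSet _).2 (latticeGraph_adj_apartmentEnum_succ hd A hA0 hA1 1)⟩} (fun b => ?_) (fun i j hij => ?_) hEuler
  · -- `S₀ = {A 0, A 1}` is the set of the two vertex representatives
    refine (Finset.mem_insert.trans (or_congr Iff.rfl Finset.mem_singleton)).trans ?_
    rw [exists_const, exists_const, hone, hone, hhd, htl]
    exact ⟨fun h => h.elim (fun h => Or.inl h.symm) fun h => Or.inr h.symm, fun h => h.elim (fun h => Or.inl h.symm) fun h => Or.inr h.symm⟩
  · -- the two vertex representatives are distinct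
    rw [hone, hone, hhd, htl]; exact h01
  · -- `S₁ = {e₀, e₁}` is the set of the two edge representatives
    refine (Finset.mem_insert.trans (or_congr Iff.rfl Finset.mem_singleton)).trans ⟨fun h => ?_, fun h => ?_⟩
    · rcases h with rfl | rfl
      · exact ⟨0, hg0⟩
      · exact ⟨1, hg1⟩
    · obtain ⟨j, rfl⟩ := h
      fin_cases j
      · exact Or.inl hg0
      · exact Or.inr hg1
  · -- the edge representatives are injective on `Fin 2`
    fin_cases i <;> fin_cases j
    · rfl
    · exact absurd (hg0.symm.trans (hij.trans hg1)) he01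
    · exact absurd (hg0.symm.trans (hij.symm.trans hg1)) he01
    · rfl

end Discharge

end Summit.HodgeConjecture.HodgeConjecture.Cruxes.H413.F0P3cStCharTSEPInducedTraceZeroAtDatum
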